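import Summits.PneNP.PneNP.Theorems.SymmetryBudgetNoHiddenOrderProgramSrcsC

/-!
# `NoHiddenOrder` (stmt-PneNP-14781), (R2c) VI: the window canoniser program — dispatch

Route `PneNP/SymmetryBudget`; continues `SymmetryBudgetNoHiddenOrderProgramSrcsC.lean`.  The KIND and SOURCE SET of every gate of `Gt m`
(`kind`, `srcs`: the constants, the symmetrised adjacency gates reading the input matrix, the signature comparison, the root refinement, the
per-label walk / value modules, and the output gates following `GraphReadout.outM`).  The rank is `…ProgramLevels.lean`.  Definitions only;
supports stmt-PneNP-14781.
-/

set_option linter.dupNamespace false -- `Summit.PneNP.PneNP.…` (D-0017 single-conjunct layout)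

namespace Summit.PneNP.PneNP.Theorems

open Finset CGBits BranchSum Literature.Computability.Complexity Literature.Computability.Complexity.SymProg

namespace WCanon

variable {m : ℕ}

/-! ### Dispatch -/

/-- **The kind of a gate.** [folklore] -/
def kind : Gt m → Kind
  | .tt => .and
  | .ff => .or
  | .adjW _ _ => .or
  | .adjO _ _ => .or
  | .sig g => vsKind g
  | .root g => riKind g
  | .an L _ g => anKind L g
  | .tr _ _ g => trKind g
  | .vor L g => orKind L g
  | .vand _ g => andKind g
  | .vl _ g => vlKind g
  | .woc _ _ _ _ => .and
  | .out _ => .or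

/-- **The sources of a gate.** [folklore] -/
noncomputable def srcs : Gt m → Finset (Wire m)
  | .tt => ∅
  | .ff => ∅
  | .adjW u v => if u = v then ∅ else {Sum.inl (u.1, v.1), Sum.inl (v.1, u.1)}
  | .adjO u b => if u.1 = b then ∅ else {Sum.inl (u.1, b), Sum.inl (b, u.1)}
  | .sig g => vsSrcs sigW .sig g
  | .root g => riSrcs (rootIn m) .root g
  | .an L k g => anSrcs L (stIn L k) (.an L k) g
  | .tr L k g => trSrcs L (stIn L k.castSucc) (.an L k.castSucc) (.tr L k) g
  | .vor L g => orSrcs L g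
  | .vand L g => andSrcs L g
  | .vl L g => vlSrcs L g
  | .woc a b u c => {Sum.inr (.vl (rootLabOf u) (.bit (cIdx (wposW u a) c))), Sum.inr (.root (.vval u c)), Sum.inr (.adjO u b)}
  | .out q =>
      if ha : q.1 ∈ windowSet m then
        if hb : q.2 ∈ windowSet m then
          {Sum.inr (.vl (rootLab m (Finset.card_pos.2 ⟨q.1, ha⟩))
            (.bit (aIdx (GraphReadout.wpos (windowSet m) rfl q.1 ha) (GraphReadout.wpos (windowSet m) rfl q.2 hb))))}
        else univ.image fun uc : WV m × Fin (wn m) => Sum.inr (.woc q.1 q.2 uc.1 uc.2)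
      else
        if q.2 ∈ windowSet m then univ.image fun uc : WV m × Fin (wn m) => Sum.inr (.woc q.2 q.1 uc.1 uc.2)
        else if q.1 = q.2 then ∅ else {Sum.inl q, Sum.inl (q.2, q.1)}

end WCanon

end Summit.PneNP.PneNP.Theorems
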